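import Mathlib
import Literature.MathematicalPhysics.QuantumLattice.EuclideanAction
import Literature.MathematicalPhysics.QuantumLattice.SchwartzTensor
import Literature.MathematicalPhysics.QuantumFieldTheory.OSLorentzInvariance

/-!
# Sketch — crux idea `finite-modular-orbit` for `MirrorModularBoosts.SoftKernelBoostCovariance`
(stmt-QuantumFields-14999; crux-ideate round 1, ideator 1)

Three model-blind lemmas of the line "a finite modular orbit is an almost-periodic boost":

* `re_eq_zero_of_norm_expSum_const` — LEVEL 1 PINS THE MODULAR SPECTRUM: a finite vector-valued
  exponential sum `t ↦ ∑ e^{μ t} v_μ` of constant norm has purely imaginary exponents (statement; the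
  Lean proof needs linear independence of characters + almost-periodic decay, size M).
* `laurent_pos_bounded_const` — a Laurent polynomial bounded on the POSITIVE ray `(0, ∞)` is constant
  (PROVED; adapted from `Sieve.laurent_bounded_const` of `Lines/boosts_inherit_mirrors.lean`, which asks
  boundedness on `ℝ ∖ 0`: only the axis ray is needed, no diagonal ray, no parity).
* `orbitCoeff_eq_zero_of_bounded` — THE HAND-OFF TO THE SIEVE: if the doubled orbit function
  `θ ↦ 𝔖(R_θ·H) = ∑_{|k|≤K} p_k e^{4ikθ}` has a continuation `χ ↦ ∑ p_k e^{-4kχ}` that is BOUNDED on `ℝ`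
  (almost-periodicity of the boosted correlator), then `p_k = 0` for EVERY `k ≠ 0` — the conclusion of
  `BoostsInheritMirrors.stub_levelGrowth` in strengthened form (all `k ≠ 0`, not only `|k| ≥ 2`), for
  every level at once (PROVED from the previous lemma by `s = e^{-4χ}`).
-/

noncomputable section

namespace Summit.QuantumFields.YangMills.Cruxes.SoftKernelBoostCovariance.FiniteModularOrbit

open scoped BigOperators
open Filter Topology

/-- **Level 1 pins the modular spectrum.**  If a finite exponential sum of fixed vectors
`v(t) = ∑_{μ ∈ s} e^{μ t} v_μ` has constant norm on `ℝ`, every exponent carrying a non-zero vector is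
purely imaginary.  (In the line: `v(t) = α_t(A)(f)Ω = Δ^{it} A(f∘Λ_t) Ω`, whose norm is the BOOSTED two-point
function, constant by level-1 isotropy of `S₂`; the `v_μ = A_μ(f)Ω` are the components of the curvature field in
its finite modular multiplet, non-zero because `Ω` is separating for wedge-local fields.) -/
theorem re_eq_zero_of_norm_expSum_const {E : Type*} [NormedAddCommGroup E] [NormedSpace ℂ E]
    (s : Finset ℂ) (v : ℂ → E) (C : ℝ)
    (h : ∀ t : ℝ, ‖∑ μ ∈ s, Complex.exp (μ * (t : ℂ)) • v μ‖ = C) :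
    ∀ μ ∈ s, v μ ≠ 0 → μ.re = 0 := by
  sorry

/-- Top coefficient of a Laurent polynomial bounded on `[1, ∞)` vanishes
(verbatim the argument of `BoostsInheritMirrors.Sieve.top_coeff_zero`). -/
theorem top_coeff_zero (a K : ℤ) (hK : 0 < K) (haK : a ≤ K) (c : ℤ → ℂ) (M : ℝ)
    (hb : ∀ s : ℝ, 1 ≤ s → ‖∑ k ∈ Finset.Icc a K, c k * (s : ℂ) ^ k‖ ≤ M) : c K = 0 := by
  set g : ℝ → ℂ := fun s => (∑ k ∈ Finset.Icc a K, c k * (s : ℂ) ^ k) * (s : ℂ) ^ (-K) with hg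
  have h1 : Tendsto g atTop (𝓝 (c K)) := by
    have hev : g =ᶠ[atTop] fun s => ∑ k ∈ Finset.Icc a K, c k * (s : ℂ) ^ (k - K) := by
      filter_upwards [eventually_ge_atTop (1 : ℝ)] with s hs
      have hs0 : (s : ℂ) ≠ 0 := by exact_mod_cast (by linarith : s ≠ 0)
      simp only [hg, Finset.sum_mul]
      refine Finset.sum_congr rfl fun k _ => ?_
      rw [mul_assoc, ← zpow_add₀ hs0, sub_eq_add_neg]
    refine Tendsto.congr' hev.symm ?_
    have hlim : ∀ k ∈ Finset.Icc a K,
        Tendsto (fun s : ℝ => c k * (s : ℂ) ^ (k - K)) atTop (𝓝 (if k = K then c K else 0)) := by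
      intro k hk
      by_cases hkK : k = K
      · subst hkK; simp
      · have hneg : k - K < 0 := by
          have := (Finset.mem_Icc.mp hk).2
          omega
        simp only [hkK, if_false]
        have h0 : Tendsto (fun s : ℝ => (s : ℂ) ^ (k - K)) atTop (𝓝 0) := by
          have hr : Tendsto (fun s : ℝ => s ^ (k - K)) atTop (𝓝 0) := tendsto_zpow_atTop_zero hneg
          have := (Complex.continuous_ofReal.tendsto 0).comp hr
          simpa [Function.comp_def, Complex.ofReal_zpow] using this
        simpa using (tendsto_const_nhds (x := c k)).mul h0
    have := tendsto_finsetSum (Finset.Icc a K) hlim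
    simpa [Finset.sum_ite_eq', Finset.mem_Icc, haK, le_refl, hK.le] using this
  have h2 : Tendsto g atTop (𝓝 0) := by
    have hbound : ∀ᶠ s in atTop, ‖g s‖ ≤ M * s ^ (-K) := by
      filter_upwards [eventually_ge_atTop (1 : ℝ)] with s hs
      have hs0 : (0 : ℝ) < s := by linarith
      rw [hg, norm_mul, norm_zpow, Complex.norm_real, Real.norm_of_nonneg hs0.le]
      exact mul_le_mul_of_nonneg_right (hb s hs) (zpow_nonneg hs0.le _)
    have hM : Tendsto (fun s : ℝ => M * s ^ (-K)) atTop (𝓝 0) := by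
      simpa using (tendsto_zpow_atTop_zero (by omega : -K < 0)).const_mul M
    exact squeeze_zero_norm' hbound hM
  exact tendsto_nhds_unique h1 h2

/-- Reflection `k ↦ -k` of a symmetric-range Laurent polynomial is evaluation at `s⁻¹`. -/
theorem laurent_reflect (K : ℕ) (c : ℤ → ℂ) (s : ℂ) :
    ∑ k ∈ Finset.Icc (-(K : ℤ)) K, c (-k) * s ^ k = ∑ k ∈ Finset.Icc (-(K : ℤ)) K, c k * s⁻¹ ^ k := by
  refine Finset.sum_equiv (Equiv.neg ℤ) (fun k => ?_) (fun k _ => ?_)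
  · simp only [Finset.mem_Icc, Equiv.neg_apply]
    omega
  · rw [Equiv.neg_apply, inv_zpow', neg_neg]

/-- **A Laurent polynomial bounded on the positive ray `(0, ∞)` is constant.**  Only ONE ray: in the line the
boundedness comes from almost-periodicity of the boosted correlator, not from positivity on two rays, so the
diagonal-frame ray and the parity sieve are not needed downstream of level 1. -/
theorem laurent_pos_bounded_const (K : ℕ) (c : ℤ → ℂ) (M : ℝ)
    (hb : ∀ s : ℝ, 0 < s → ‖∑ k ∈ Finset.Icc (-(K : ℤ)) K, c k * (s : ℂ) ^ k‖ ≤ M) :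
    ∀ k ∈ Finset.Icc (-(K : ℤ)) K, k ≠ 0 → c k = 0 := by
  induction K with
  | zero =>
    intro k hk hk0
    simp only [CharP.cast_eq_zero, neg_zero, Finset.Icc_self, Finset.mem_singleton] at hk
    exact absurd hk hk0
  | succ K ih =>
    have htop : c ((K : ℤ) + 1) = 0 := by
      refine top_coeff_zero (-((K : ℤ) + 1)) ((K : ℤ) + 1) (by omega) (by omega) c M fun s hs => ?_
      have := hb s (by linarith)
      simpa using this
    have hbot : c (-((K : ℤ) + 1)) = 0 := by
      have := top_coeff_zero (-((K : ℤ) + 1)) ((K : ℤ) + 1) (by omega) (by omega) (fun k => c (-k)) M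
        fun s hs => ?_
      · simpa using this
      · have hs0 : (0 : ℝ) < s := by linarith
        have hrefl := laurent_reflect (K + 1) c (s : ℂ)
        push_cast at hrefl ⊢
        rw [hrefl]
        have := hb s⁻¹ (inv_pos.mpr hs0)
        simpa [Complex.ofReal_inv] using this
    have hsub : Finset.Icc (-(K : ℤ)) K ⊆ Finset.Icc (-((K : ℤ) + 1)) ((K : ℤ) + 1) :=
      Finset.Icc_subset_Icc (by omega) (by omega)
    have hK : ∀ k ∈ Finset.Icc (-(K : ℤ)) K, k ≠ 0 → c k = 0 := by
      refine ih fun s hs => ?_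
      have heq : ∑ k ∈ Finset.Icc (-(K : ℤ)) K, c k * (s : ℂ) ^ k =
          ∑ k ∈ Finset.Icc (-((K : ℤ) + 1)) ((K : ℤ) + 1), c k * (s : ℂ) ^ k := by
        refine Finset.sum_subset hsub fun k hk hk' => ?_
        have hk1 : k = (K : ℤ) + 1 ∨ k = -((K : ℤ) + 1) := by
          simp only [Finset.mem_Icc, not_and_or, not_le] at hk hk'
          omega
        rcases hk1 with rfl | rfl
        · rw [htop, zero_mul]
        · rw [hbot, zero_mul]
      rw [heq]
      have := hb s hs
      push_cast at this ⊢
      exact this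
    intro k hk hk0
    by_cases hkin : k ∈ Finset.Icc (-(K : ℤ)) K
    · exact hK k hkin hk0
    · have hk1 : k = (K : ℤ) + 1 ∨ k = -((K : ℤ) + 1) := by
        simp only [Finset.mem_Icc, not_and_or, not_le] at hk hkin
        push_cast at hk
        omega
      rcases hk1 with rfl | rfl
      · exact htop
      · exact hbot

/-- `e^{-4kχ} = s^k` for `s = e^{-4χ}`: the boost rapidity `χ` and the pencil variable `s`. -/
theorem exp_neg_four_mul (k : ℤ) (χ : ℝ) :
    (Real.exp (-4 * (k : ℝ) * χ) : ℂ) = ((Real.exp (-4 * χ) : ℝ) : ℂ) ^ k := by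
  rw [← Complex.ofReal_zpow]
  congr 1
  rw [← Real.rpow_intCast, ← Real.exp_mul]
  congr 1
  ring

/-- **Hand-off to the sieve (all levels at once).**  If the pencil coefficients `p_k` of a doubled orbit function
give a BOUNDED function `χ ↦ ∑_{|k| ≤ K} p_k e^{-4kχ}` on `ℝ` — i.e. the boosted correlator
`‖Ψ^χ_F‖² = 𝔖(R_{iχ}·(ΘF*⊗F))` is bounded in the rapidity, as it is when the curvature field sits in a finite
modular multiplet with purely imaginary exponents — then `p_k = 0` for every `k ≠ 0`.  This is the conclusion of
`BoostsInheritMirrors.stub_levelGrowth` (which asks it only for `|k| ≥ 2` and leaves `k = ±1` to parity) for every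
level `a`, with no induction on `a` and no UV input. -/
theorem orbitCoeff_eq_zero_of_bounded (K : ℕ) (p : ℤ → ℂ)
    (hB : ∃ B : ℝ, ∀ χ : ℝ,
      ‖∑ k ∈ Finset.Icc (-(K : ℤ)) K, p k * (Real.exp (-4 * (k : ℝ) * χ) : ℂ)‖ ≤ B) :
    ∀ k ∈ Finset.Icc (-(K : ℤ)) K, k ≠ 0 → p k = 0 := by
  obtain ⟨B, hB⟩ := hB
  refine laurent_pos_bounded_const K p B fun s hs => ?_
  -- `s = e^{-4χ}` with `χ = -(log s)/4`
  have hχ : Real.exp (-4 * (-(Real.log s) / 4)) = s := by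
    have : -4 * (-(Real.log s) / 4) = Real.log s := by ring
    rw [this, Real.exp_log hs]
  have hBs := hB (-(Real.log s) / 4)
  have heq : ∀ k : ℤ, (Real.exp (-4 * (k : ℝ) * (-(Real.log s) / 4)) : ℂ) = (s : ℂ) ^ k := by
    intro k
    rw [exp_neg_four_mul k, hχ]
  have key : ∑ k ∈ Finset.Icc (-(K : ℤ)) K, p k * (s : ℂ) ^ k =
      ∑ k ∈ Finset.Icc (-(K : ℤ)) K, p k * (Real.exp (-4 * (k : ℝ) * (-(Real.log s) / 4)) : ℂ) :=
    Finset.sum_congr rfl fun k _ => by rw [heq k]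
  rw [key]
  exact hBs

/-- The ORBIT-FUNCTION form over tree vocabulary (statement shape of the hand-off for a one-species family on `ℝ⁴`,
`planeRot 0 θ` = rotation of the `(x₀,x₁)`-plane): whenever the rigid-rotation orbit function of an off-diagonal
test function is a trigonometric polynomial in `e^{4iθ}` whose rapidity continuation is bounded, the orbit function
is constant.  `E4 := EuclideanSpace ℝ (Fin 4)`. -/
theorem orbit_const_of_bounded
    (S : Literature.MathematicalPhysics.QuantumLattice.SchwingerFamily (EuclideanSpace ℝ (Fin 4)))
    (n : ℕ) (H : SchwartzMap (Fin n → EuclideanSpace ℝ (Fin 4)) ℂ) (K : ℕ) (p : ℤ → ℂ)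
    (horbit : ∀ θ : ℝ,
      S n (Literature.MathematicalPhysics.QuantumLattice.linActMulti
        (Literature.MathematicalPhysics.QuantumFieldTheory.planeRot (d := 3) 0 θ) H) =
        ∑ k ∈ Finset.Icc (-(K : ℤ)) K, p k * Complex.exp (4 * (k : ℂ) * (θ : ℂ) * Complex.I))
    (hB : ∃ B : ℝ, ∀ χ : ℝ,
      ‖∑ k ∈ Finset.Icc (-(K : ℤ)) K, p k * (Real.exp (-4 * (k : ℝ) * χ) : ℂ)‖ ≤ B) :
    ∀ θ : ℝ,
      S n (Literature.MathematicalPhysics.QuantumLattice.linActMulti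
        (Literature.MathematicalPhysics.QuantumFieldTheory.planeRot (d := 3) 0 θ) H) = p 0 := by
  intro θ
  rw [horbit θ]
  have hz := orbitCoeff_eq_zero_of_bounded K p hB
  have h0 : (0 : ℤ) ∈ Finset.Icc (-(K : ℤ)) K := by simp
  rw [Finset.sum_eq_single_of_mem 0 h0 (fun k hk hk0 => by rw [hz k hk hk0, zero_mul])]
  simp

end Summit.QuantumFields.YangMills.Cruxes.SoftKernelBoostCovariance.FiniteModularOrbit

end
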